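import Literature.AlgebraicGeometry.Resolution.RegularLocusOpen
import Mathlib.AlgebraicGeometry.Stalk
import Mathlib.AlgebraicGeometry.Morphisms.Proper
import HarnessLib

/-!
# The regular locus of a reduced scheme is dense; Step 0 of Cossart–Piltant Thm. 1.1

Topic: `Literature/AlgebraicGeometry/Resolution`. Supporting lemmas for the named fact
`CossartPiltant2019General` (`QuasiExcellentSchemes.lean`, Cossart–Piltant 2019, Thm. 1.1 as
printed). The printed theorem produces a proper `π : 𝒳' → 𝒳` with (i) `𝒳'` regular, (ii) `π` an
isomorphism `π⁻¹(Reg 𝒳) ≃ Reg 𝒳`, (iii) `π⁻¹(Sing 𝒳)` a strict normal crossings divisor, and calls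
`π` "birational"; the vendored conclusion asks for `IsResolution π` (proper, `IsBirational` = an
isomorphism over a DENSE open with DENSE preimage, `𝒳'` regular) together with (ii). The passage
from the printed shape to the vendored one ("Step 0") rests on two facts about the regular locus
of the base, both PROVED here in full generality:

* `Scheme.dense_regularLocus` — **the regular locus of a reduced scheme is dense**: the local
  ring at a maximal point (generic point of an irreducible component) of a reduced scheme is a
  field (Mathlib's `AlgebraicGeometry.isField_stalk_of_closure_mem_irreducibleComponents`;
  `x ∈ genericPoints X` is definitionally `closure {x} ∈ irreducibleComponents X`), hence
  regular, and the maximal points are dense in any (quasi-sober) scheme.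
* `Scheme.isOpen_regularLocus_of_isQuasiExcellent` — the regular locus of a quasi-excellent
  scheme is open (the J-2 property; `RegularLocusOpen.lean` applied to `𝟙 X`).

and the packaging lemmas

* `isBirational_of_isIso_restrict` — an isomorphism over an open `U ⊇ Reg X` of a reduced `X`
  with dense preimage is birational;
* `exists_isResolution_of_isIso_restrict_regularLocus` — printed (i) + (ii) + properness +
  density of `π⁻¹(Reg 𝒳)` give exactly the conclusion of `CossartPiltant2019General` for `𝒳`;
* `exists_isResolution_of_isRegular` — the trivial case: a regular scheme is resolved by its
  identity, with `U = ⊤ = Reg X`.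

No new definitions and no named facts are introduced.

## Sources

* V. Cossart, O. Piltant, *Resolution of singularities of arithmetical threefolds*, J. Algebra
  529 (2019) 268–535 = arXiv:1412.0868, Thm. 1.1 and the paragraph following it (p. 3: "A proper
  birational morphism `π` with property (i) was called a resolution of singularities by
  Grothendieck [EGA2] (7.9.1), though more recent terminology (this article included) tends to
  require property (ii) as well"). [CossartPiltant2019]
* The Stacks Project, Tag 01J7 (points of `Spec 𝒪_{X,x}`), Tag 01RN (birational).
  [StacksProject]
-/

noncomputable section

open CategoryTheory AlgebraicGeometry TopologicalSpace Topology

namespace Literature.AlgebraicGeometry.Resolution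

universe u

/-! ## Maximal points of a reduced scheme are regular points -/

/-- A maximal point of a scheme (a generic point of an irreducible component, Mathlib
`genericPoints`) has no proper generization. [folklore] -/
theorem eq_of_specializes_of_mem_genericPoints {X : Scheme.{u}} {x y : X}
    (hx : x ∈ genericPoints X) (h : y ⤳ x) : y = x := by
  have hxy : closure ({x} : Set X) ⊆ closure {y} := by
    rw [(isClosed_closure).closure_subset_iff, Set.singleton_subset_iff]
    exact specializes_iff_mem_closure.mp h
  have hyx : closure ({y} : Set X) ⊆ closure {x} :=
    hx.2 isIrreducible_singleton.closure hxy
  have h' : x ⤳ y := specializes_iff_mem_closure.mpr (hyx (subset_closure rfl))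
  exact (h.antisymm h').eq

/-- At a maximal point `x` of a scheme, every prime of `𝒪_{X,x}` is the maximal ideal: the image
of `Spec 𝒪_{X,x} → X` is the set of generizations of `x` (Stacks 01J7), which is `{x}`, and this
map is injective. [cite: StacksProject, Tag 01J7] -/
theorem PrimeSpectrum.eq_closedPoint_stalk_of_mem_genericPoints {X : Scheme.{u}} {x : X}
    (hx : x ∈ genericPoints X) (p : PrimeSpectrum (X.presheaf.stalk x)) :
    p = IsLocalRing.closedPoint (X.presheaf.stalk x) := by
  apply (X.fromSpecStalk x).isEmbedding.injective
  rw [Scheme.fromSpecStalk_closedPoint]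
  apply eq_of_specializes_of_mem_genericPoints hx
  have hp : (X.fromSpecStalk x) p ∈ Set.range (X.fromSpecStalk x) := Set.mem_range_self p
  rwa [Scheme.range_fromSpecStalk] at hp

/-- The local ring of a reduced scheme at a maximal point is a regular local ring: it is a field by
Mathlib's `AlgebraicGeometry.isField_stalk_of_closure_mem_irreducibleComponents` (it is reduced and
its maximal ideal is its only prime; `x ∈ genericPoints X` is definitionally
`closure {x} ∈ irreducibleComponents X`). [folklore] -/
theorem isRegularLocalRing_stalk_of_mem_genericPoints {X : Scheme.{u}} [IsReduced X] {x : X}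
    (hx : x ∈ genericPoints X) : IsRegularLocalRing (X.presheaf.stalk x) := by
  letI := (isField_stalk_of_closure_mem_irreducibleComponents X x hx).toField
  infer_instance

/-- The maximal points of a reduced scheme are regular points. [folklore] -/
theorem Scheme.genericPoints_subset_regularLocus (X : Scheme.{u}) [IsReduced X] :
    genericPoints X ⊆ Scheme.regularLocus X :=
  fun _ hx => isRegularLocalRing_stalk_of_mem_genericPoints hx

/-! ## Density and openness of the regular locus -/

/-- The maximal points of a scheme are dense. [folklore] -/
theorem Scheme.dense_genericPoints (X : Scheme.{u}) : Dense (genericPoints X) :=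
  dense_iff_closure_eq.mpr genericPoints.closure

/-- **The regular locus of a reduced scheme is dense** (it contains every maximal point).
[folklore] -/
theorem Scheme.dense_regularLocus (X : Scheme.{u}) [IsReduced X] :
    Dense (Scheme.regularLocus X) :=
  (Scheme.dense_genericPoints X).mono (Scheme.genericPoints_subset_regularLocus X)

/-- The regular locus of a quasi-excellent scheme is open (J-2; `RegularLocusOpen.lean` for the
identity morphism). [cite: Matsumura1987, §32 p. 260 Definition] -/
theorem Scheme.isOpen_regularLocus_of_isQuasiExcellent {X : Scheme.{u}}
    (hX : Scheme.IsQuasiExcellent X) : IsOpen (Scheme.regularLocus X) :=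
  isOpen_regularLocus_of_locallyOfFiniteType (𝟙 X) hX

/-- For a quasi-excellent scheme there is an open `U ⊆ X` whose points are exactly `Reg X` (the
shape of conclusion (ii) in `CossartPiltant2019General`). [folklore] -/
theorem Scheme.exists_opens_coe_eq_regularLocus {X : Scheme.{u}}
    (hX : Scheme.IsQuasiExcellent X) :
    ∃ U : X.Opens, (U : Set X) = Scheme.regularLocus X :=
  ⟨⟨_, Scheme.isOpen_regularLocus_of_isQuasiExcellent hX⟩, rfl⟩

/-! ## Step 0 of Cossart–Piltant Thm. 1.1: from the printed conclusions to the vendored one -/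

/-- A morphism to a reduced scheme which is an isomorphism over an open `U ⊇ Reg X` with dense
preimage is birational (`Reg X` is dense). [cite: CossartPiltant2019, Thm. 1.1 (ii) and the
paragraph following it] -/
theorem isBirational_of_isIso_restrict {X' X : Scheme.{u}} [IsReduced X] (π : X' ⟶ X)
    (U : X.Opens) (hU : Scheme.regularLocus X ⊆ U) [IsIso (π ∣_ U)]
    (hd : Dense ((π ⁻¹ᵁ U : X'.Opens) : Set X')) : IsBirational π :=
  ⟨U, (Scheme.dense_regularLocus X).mono hU, hd, inferInstance⟩

/-- **Step 0 of Thm. 1.1.** For a reduced scheme `X`, a proper `π : X' ⟶ X` with `X'` regular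
(printed (i)), which is an isomorphism over an open `U` whose points are exactly `Reg X`
(printed (ii)) and whose preimage is dense in `X'` (a consequence of printed (iii): the
complement of a divisor on the regular scheme `X'`), satisfies the conclusion of
`CossartPiltant2019General` for `X`. [cite: CossartPiltant2019, Thm. 1.1] -/
theorem exists_isResolution_of_isIso_restrict_regularLocus {X' X : Scheme.{u}} [IsReduced X]
    (π : X' ⟶ X) [IsProper π] (hX' : Scheme.IsRegular X') (U : X.Opens)
    (hU : (U : Set X) = Scheme.regularLocus X) [IsIso (π ∣_ U)]
    (hd : Dense ((π ⁻¹ᵁ U : X'.Opens) : Set X')) :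
    ∃ (X'' : Scheme.{u}) (π' : X'' ⟶ X), IsResolution π' ∧
      ∃ V : X.Opens, (V : Set X) = Scheme.regularLocus X ∧ IsIso (π' ∣_ V) :=
  ⟨X', π, ⟨‹_›, isBirational_of_isIso_restrict π U hU.ge hd, hX'⟩, U, hU, ‹_›⟩

/-- The trivial case of `CossartPiltant2019General`: a regular scheme is resolved by its
identity, which is an isomorphism over `⊤ = Reg X`. [folklore] -/
theorem exists_isResolution_of_isRegular {X : Scheme.{u}} (hX : Scheme.IsRegular X) :
    ∃ (X' : Scheme.{u}) (π : X' ⟶ X), IsResolution π ∧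
      ∃ U : X.Opens, (U : Set X) = Scheme.regularLocus X ∧ IsIso (π ∣_ U) :=
  ⟨X, 𝟙 X, ⟨inferInstance, ⟨⊤, by simp [dense_univ], by simp [dense_univ], inferInstance⟩, hX⟩,
    ⊤, by simp [hX.regularLocus_eq_univ], inferInstance⟩

end Literature.AlgebraicGeometry.Resolution

end
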